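import Literature.NumberTheory.EllipticCurves.TwoIsogenyDescentOddMultipleProofs
import Literature.NumberTheory.EllipticCurves.BSDSelmerSmithCaseVProofs
import Literature.NumberTheory.EllipticCurves.VariableChangePoints
import Literature.NumberTheory.QuadraticForms.PadicSquareCriteria
import Summits.BirchSwinnertonDyer.BirchSwinnertonDyer.Theorems.GoldfeldAllTwistsTwoConverseTwinGenusDescentPartnerTwoExact
import HarnessLib

set_option linter.dupNamespace false -- `…BirchSwinnertonDyer.BirchSwinnertonDyer…` is the cell's namespace (D-0017)
set_option autoImplicit false

/-!
# The DYADIC TORSION TABLE of the split-bad class, I: `W(ℚ₂)[2^∞] = W(ℚ₂)[2] ≅ (ℤ/2)²` for the five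
# 2-adic classes `d ≡ 7 (mod 8)` and `d ≡ 2 (mod 4)` of `W_d : y² = x³ + 21d·x² + 112d²·x` (`= 49a1^{(d)}`)

Cell `bsd-print-cf2`, width seat `bsd-line-cf2-p1-w4` g6 (`--supports stmt-BirchSwinnertonDyer-20368`, crux
`PrintCf2.SplitBadTwoRankOneOfFacts`, road α `rubin_value_two`, skeleton of record v8). Theses-free; theorems only; no
`sorry`. HONEST FRAMING: elementary arithmetic of an explicit one-parameter family of Weierstrass equations over `ℚ₂`;
nothing about `L`-values; BSD is not proved by any of this and no summit statement is proved by this seat.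

WHY (planner RULING 15:26:26Z (3), the «DYADIC TABLE» brick; scrit STUB-PLAN §4 T4). Road α's research stubs S2′/S3b
and the one-sided children (T2 additive-fibre kernel table, T3 local index) need the local arithmetic of `W = 49a1^{(d)}`
over `ℚ₂` keyed by the 2-adic square class `[d]₂`. The tree already holds, for the WHOLE additive cell (bsd-goldfeld,
`GoldfeldGoodTwists.*`), the global minimal model, `c₂ = 4`, `c₇ = 2`, `∏ c_ℓ = 2^{3+ι+2σ}`, `#W(ℚ)_tors = 2`, and
(b2b-bsdres, `Rank1Residual.Additive.LocalLog.range_padicLog_eq_span_zpow_of_hasAdditiveReduction`) the law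
`log_ω(E(ℚ_p)) = p^{t − v_p c_p} ℤ_p` at an ADDITIVE prime, `p^t = #E(ℚ_p)[p^∞]`, whose exponent `t` is bounded a
priori only for `p ≥ 3` (`LocalTorsionExponent`). The missing datum at `p = 2` is **`t([d]₂) = log₂ #W(ℚ₂)[2^∞]`**,
and it is NOT constant on the class: `t = 2` (`W(ℚ₂)[2^∞] ≅ (ℤ/2)²`) for `d ≡ 7 (8)` and the four even classes
`d ≡ 2 (4)`, but `t = 3` (`ℤ/4 × ℤ/2`) for `d ≡ 3 (8)` (key `(1,3)`, anchor `−5`) — so `log_ω(W(ℚ₂)) = 2^{t−2}ℤ₂`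
is `ℤ₂` except `2ℤ₂` on that key. THIS FILE proves the five `t = 2` classes; the sibling file treats `d ≡ 3 (8)`.

HOW. All of `W_d[2]` is `ℚ₂`-rational: the roots of `x² + 21d·x + 112d²` are `x± = (−21d ± d·s)/2`, `s = √−7 ∈ ℤ₂`
(bsd-goldfeld's `GoldfeldGoodTwists.exists_padicInt_two_sq_eq_neg_seven`).
A point `(x, y) = 2R` of `y² = x(x − e₂)(x − e₃)` has `x − e` a square for each root `e ∈ {0, e₂, e₃}`
(Silverman–Tate's homomorphism `α`, tree `xSqClass_two_nsmul`, on the model translated by `e`, tree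
`isTwoTorsionNF_smul_of_root` + `VariableChange.pointEquiv`). Hence none of `T₀ = (0,0)`, `T± = (x±, 0)` is halvable
over `ℚ₂`: `b = 112d² = 7·(4d)²` with `7 ∉ ℚ₂²`; `x± − x∓ = ±d·s` has ODD valuation when `2 ∥ d`, and for
`d ≡ 7 (mod 8)` a square root `w` of it would give `w⁴ = −7d² ≡ 9 (mod 16)`, impossible (for `d ≡ 3 (mod 8)`,
`−7d² ≡ 1 (mod 16)` and one of `T±` IS halvable). So `W_d(ℚ₂)[2^∞] = W_d(ℚ₂)[2]` has `4` elements. Stated for any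
`V/ℚ₂` in two-torsion normal form with `a₂ = 21u`, `a₄ = 112u²`, `u ∈ ℤ`: applies verbatim to `W_d.baseChange ℚ_[2]`
for the anchors' two-torsion models (`…RubinValueTwoAnchorsFiveTen/SixSixtyTwo`) and, by `ℚ₂`-isomorphism, to every
model of `49a1^{(d)}`. References: [SilvermanTate2015] §3.5; [SilvermanAEC2009] III.1, X.1 (proof of Prop. 1.4);
[Serre1973] Ch. II §3.3 Thm 4.
-/


noncomputable section

open scoped Classical

open WeierstrassCurve Literature.NumberTheory.QuadraticForms

namespace Summit.BirchSwinnertonDyer.BirchSwinnertonDyer.Theorems.PrintCf2.DyadicTorsion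

/-! ## §1 The halving obstruction on a curve with full two-torsion (any field) -/

section Halving

variable {F : Type*} [Field F] (V : WeierstrassCurve F) [V.IsTwoTorsionNF] [V.IsElliptic]

/-- **If `2R = (x, y)` on `y² = x³ + a x² + b x` and `e` is `0` or a root of `X² + aX + b`, then `x − e` is a square.**
(Translate by `e`: the model `⟨1, e, 0, 0⟩ • V` is again in two-torsion normal form, the induced isomorphism of point
groups sends `(x, y) ↦ (x − e, y)`, and Silverman–Tate's `α` kills `2V(F)`.) [cite: SilvermanTate2015, §3.5] -/
theorem isSquare_x_sub_of_two_nsmul_eq {e : F} (he : e = 0 ∨ e ^ 2 + V.a₂ * e + V.a₄ = 0)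
    {R : V.toAffine.Point} {x y : F} {h : V.toAffine.Nonsingular x y}
    (hR : 2 • R = .some x y h) : IsSquare (x - e) := by
  set C : VariableChange F := ⟨1, e, 0, 0⟩ with hC
  have hroot : e ^ 3 + V.a₂ * e ^ 2 + V.a₄ * e = 0 := by
    rcases he with he | he
    · rw [he]; ring
    · linear_combination e * he
  haveI : (C • V).IsTwoTorsionNF := isTwoTorsionNF_smul_of_root V hroot
  have h2 : (C • V).xSqClass (VariableChange.pointEquiv V C (2 • R)) = 1 := by
    rw [map_nsmul]; exact (C • V).xSqClass_two_nsmul _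
  rw [hR, VariableChange.pointEquiv_some] at h2
  have hX : C.toX x = x - e := by
    rw [VariableChange.toX_def, hC]; simp
  by_cases hxe : x - e = 0
  · rw [hxe]; exact ⟨0, (mul_zero 0).symm⟩
  · rw [xSqClass_some_of_ne_zero _ (by rwa [hX]), hX, Affine.sqClass_eq_one_iff hxe] at h2
    obtain ⟨w, hw⟩ := h2
    exact ⟨w, by rw [hw, sq]⟩

/-- A `2`-torsion point `T = (e, 0)` with `e − e'` a non-square, for another root `e'` (or `e' = 0`), is not halvable:
`2Q ≠ T` for every `Q`. [cite: SilvermanTate2015, §3.5] -/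
theorem two_nsmul_ne_of_not_isSquare_sub {e e' : F} (he' : e' = 0 ∨ e' ^ 2 + V.a₂ * e' + V.a₄ = 0)
    (hne : ¬ IsSquare (e - e')) {h : V.toAffine.Nonsingular e 0} (Q : V.toAffine.Point) :
    2 • Q ≠ .some e 0 h := fun hQ =>
  hne (isSquare_x_sub_of_two_nsmul_eq V he' hQ)

/-- On `y² = x³ + a x² + b x`: if `X² + aX + b = (X − e₂)(X − e₃)` then the points killed by `2` are exactly
`O, (0,0), (e₂,0), (e₃,0)`. [cite: SilvermanAEC2009, Group Law Algorithm III.2.3] -/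
theorem two_nsmul_eq_zero_iff_of_roots {e₂ e₃ : F} (hsum : e₂ + e₃ = -V.a₂) (hprod : e₂ * e₃ = V.a₄)
    (P : V.toAffine.Point) :
    2 • P = 0 ↔ P = 0 ∨ ∃ (x : F) (hx : V.toAffine.Nonsingular x 0), (x = 0 ∨ x = e₂ ∨ x = e₃) ∧
      P = .some x 0 hx := by
  constructor
  · intro hP
    rcases P with _ | ⟨x, y, hxy⟩
    · exact Or.inl rfl
    · right
      have hy : y = 0 := (V.two_nsmul_eq_zero_iff_y_eq_zero hxy).mp hP
      subst hy
      refine ⟨x, hxy, ?_, rfl⟩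
      have e := rel_of_nonsingular V hxy
      have hx : x * ((x - e₂) * (x - e₃)) = 0 := by
        have : (x - e₂) * (x - e₃) = x ^ 2 + V.a₂ * x + V.a₄ := by
          linear_combination (-x) * hsum + hprod
        rw [this]; linear_combination -e
      rcases mul_eq_zero.mp hx with hx | hx
      · exact Or.inl hx
      · rcases mul_eq_zero.mp hx with hx | hx
        · exact Or.inr (Or.inl (sub_eq_zero.mp hx))
        · exact Or.inr (Or.inr (sub_eq_zero.mp hx))
  · rintro (rfl | ⟨x, hx, -, rfl⟩)
    · exact nsmul_zero _
    · exact (V.two_nsmul_eq_zero_iff_y_eq_zero hx).mpr rfl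

end Halving

/-! ## §2 Squares in `ℚ₂`: the inputs keyed by residues -/

section TwoAdic

/-- An odd integer is a `2`-adic unit: `‖n‖₂ = 1`. [folklore] -/
theorem norm_intCast_eq_one_of_odd {n : ℤ} (hn : Odd n) : ‖(n : ℤ_[2])‖ = 1 := by
  rw [PadicInt.norm_intCast_eq_one_iff]
  obtain ⟨k, rfl⟩ := hn
  exact ⟨1, -k, by ring⟩

/-- A `2`-adic integer `s` with `s² = c`, `c` an odd integer, is a unit. [folklore] -/
theorem isUnit_of_sq_eq_intCast {s : ℤ_[2]} {c : ℤ} (hc : Odd c) (hs : s ^ 2 = c) : IsUnit s := by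
  rw [PadicInt.isUnit_iff]
  have h : ‖s‖ ^ 2 = 1 := by
    rw [PadicInt.norm_def, ← norm_pow, ← PadicInt.coe_pow, hs, ← PadicInt.norm_def]
    exact norm_intCast_eq_one_of_odd hc
  have h0 : 0 ≤ ‖s‖ := norm_nonneg _
  nlinarith

/-- A square of `ℚ₂` lying in `ℤ₂` is the square of an element of `ℤ₂`. [folklore] -/
theorem exists_eq_mul_self_of_isSquare_coe {z : ℤ_[2]} (h : IsSquare ((z : ℤ_[2]) : ℚ_[2])) :
    ∃ w : ℤ_[2], z = w * w := by
  obtain ⟨w, hw⟩ := h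
  have hw1 : ‖w‖ ≤ 1 := by
    rcases le_or_gt ‖w‖ 1 with hle | hlt
    · exact hle
    · have : 1 < ‖(z : ℚ_[2])‖ := by
        rw [hw, norm_mul]; nlinarith
      exact absurd (PadicInt.norm_le_one z) (by rw [PadicInt.norm_def]; exact not_le.mpr this)
  refine ⟨⟨w, hw1⟩, ?_⟩
  apply Subtype.ext
  push_cast
  exact hw

/-- **Residue obstruction.** If no `x ∈ ℤ/2ⁿ` has `x² = z mod 2ⁿ`, then `z ∈ ℤ₂` is not a square in `ℚ₂`.
[cite: Serre1973, Ch. II §3.3 Thm 4] -/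
theorem not_isSquare_coe_of_forall_sq_ne {z : ℤ_[2]} (n : ℕ)
    (hz : ∀ x : ZMod (2 ^ n), x ^ 2 ≠ PadicInt.toZModPow n z) : ¬ IsSquare ((z : ℤ_[2]) : ℚ_[2]) := by
  intro h
  obtain ⟨w, hw⟩ := exists_eq_mul_self_of_isSquare_coe h
  refine hz (PadicInt.toZModPow n w) ?_
  rw [sq, ← map_mul, ← hw]

/-- **Fourth-power obstruction.** If `s² = c` in `ℤ₂` and no `x ∈ ℤ/16` has `x⁴ = c`, then `s` is not a square in
`ℚ₂` (a square root `w` would have `w⁴ = c`). Used with `c = −7d²`, `d ≡ 7 (mod 8)`: `−7d² ≡ 9 (mod 16)` while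
fourth powers are `0, 1 (mod 16)`. [cite: Serre1973, Ch. II §3.3 Thm 4] -/
theorem not_isSquare_coe_of_sq_eq_of_forall_pow_four_ne {s : ℤ_[2]} {c : ℤ} (hs : s ^ 2 = c)
    (hc : ∀ x : ZMod (2 ^ 4), x ^ 4 ≠ (c : ZMod (2 ^ 4))) : ¬ IsSquare ((s : ℤ_[2]) : ℚ_[2]) := by
  intro h
  obtain ⟨w, hw⟩ := exists_eq_mul_self_of_isSquare_coe h
  refine hc (PadicInt.toZModPow 4 w) ?_
  have h4 : w ^ 4 = (c : ℤ_[2]) := by rw [← hs, hw]; ring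
  rw [← map_pow, h4, map_intCast]

/-- `2 · (unit)` is not a square in `ℚ₂` (odd valuation). [cite: Serre1973, Ch. II §3.3 Thm 4] -/
theorem not_isSquare_two_mul_coe_of_isUnit {v : ℤ_[2]} (hv : IsUnit v) :
    ¬ IsSquare ((2 : ℚ_[2]) * ((v : ℤ_[2]) : ℚ_[2])) := by
  obtain ⟨v, rfl⟩ := hv
  intro h
  have h' := (padic_two_isSquare_zpow_mul_unit_iff v 1).mp (by rwa [zpow_one])
  exact (by decide : ¬ Even (1 : ℤ)) h'.1

/-- `7` is not a square in `ℚ₂` (`7 ≢ 1 (mod 8)`). [cite: Serre1973, Ch. II §3.3 Thm 4] -/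
theorem not_isSquare_seven : ¬ IsSquare ((7 : ℚ_[2])) := by
  have h := not_isSquare_coe_of_forall_sq_ne (z := (7 : ℤ_[2])) 3 (by
    rw [map_ofNat, show (2 : ℕ) ^ 3 = 8 by norm_num]; decide)
  exact_mod_cast h

/-- `112 u² = 7 · (4u)²` is not a square in `ℚ₂` for `u ≠ 0`. [cite: Serre1973, Ch. II §3.3 Thm 4] -/
theorem not_isSquare_b {u : ℚ_[2]} (hu : u ≠ 0) : ¬ IsSquare (112 * u ^ 2) := by
  rintro ⟨w, hw⟩
  refine not_isSquare_seven ⟨w / (4 * u), ?_⟩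
  have h4u : (4 : ℚ_[2]) * u ≠ 0 := mul_ne_zero (by norm_num) hu
  field_simp
  linear_combination hw

end TwoAdic

/-! ## §3 The family `V : y² = x³ + 21u·x² + 112u²·x` over `ℚ₂`: full two-torsion, and the torsion table for
`u ≡ 7 (mod 8)` and `u ≡ 2 (mod 4)` -/

section Family

variable (V : WeierstrassCurve ℚ_[2]) [V.IsTwoTorsionNF] [V.IsElliptic] {u : ℤ}
  (ha : V.a₂ = 21 * (u : ℚ_[2])) (hb : V.a₄ = 112 * (u : ℚ_[2]) ^ 2)

omit [V.IsTwoTorsionNF] [V.IsElliptic] in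
include ha hb in
/-- The two-division quadratic splits over `ℚ₂`: with `s² = −7`, `x± = (−21u ± u s)/2` satisfy
`x₊ + x₋ = −a₂`, `x₊ x₋ = a₄`. [folklore] -/
theorem roots_of_sq_eq {s : ℚ_[2]} (hs : s ^ 2 = -7) :
    (-21 * (u : ℚ_[2]) + u * s) / 2 + (-21 * (u : ℚ_[2]) - u * s) / 2 = -V.a₂ ∧
      (-21 * (u : ℚ_[2]) + u * s) / 2 * ((-21 * (u : ℚ_[2]) - u * s) / 2) = V.a₄ := by
  refine ⟨by rw [ha]; ring, by rw [hb]; linear_combination (-(u : ℚ_[2]) ^ 2 / 4) * hs⟩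

/-- A root `e` of the two-division quadratic gives a nonsingular point `(e, 0)`. [folklore] -/
theorem nonsingular_root {e : ℚ_[2]} (he : e ^ 2 + V.a₂ * e + V.a₄ = 0) : V.toAffine.Nonsingular e 0 := by
  refine Affine.equation_iff_nonsingular.mp ?_
  rw [equation_iff_of_isTwoTorsionNF]
  linear_combination (-e) * he

omit [V.IsTwoTorsionNF] [V.IsElliptic] in
/-- `x±` are roots of `X² + a₂X + a₄` (from the sum/product relations). [folklore] -/
theorem root_of_sum_prod {e₂ e₃ : ℚ_[2]} (hsum : e₂ + e₃ = -V.a₂) (hprod : e₂ * e₃ = V.a₄) :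
    e₂ ^ 2 + V.a₂ * e₂ + V.a₄ = 0 ∧ e₃ ^ 2 + V.a₂ * e₃ + V.a₄ = 0 :=
  ⟨by linear_combination e₂ * hsum - hprod, by linear_combination e₃ * hsum - hprod⟩

include hb in
/-- **`T₀ = (0,0)` is not halvable over `ℚ₂`** (`b = 7·(4u)²` is not a square). [cite: SilvermanTate2015, §3.5] -/
theorem two_nsmul_ne_twoTorsionPoint (hu : u ≠ 0) (Q : V.toAffine.Point) : 2 • Q ≠ V.twoTorsionPoint := by
  refine V.twoTorsionPoint_ne_two_nsmul ?_ Q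
  rw [hb]
  exact not_isSquare_b (by exact_mod_cast hu)

omit [V.IsTwoTorsionNF] [V.IsElliptic] in
/-- The difference of the two non-zero roots: `x₊ − x₋ = u·s`. [folklore] -/
theorem root_sub_root (s : ℚ_[2]) :
    (-21 * (u : ℚ_[2]) + u * s) / 2 - (-21 * (u : ℚ_[2]) - u * s) / 2 = u * s := by ring

/-- **Key non-square, even class**: for `u = 2m`, `m` odd, and `s² = −7`: `±u·s = 2·(±m s)` has odd valuation, so is
not a square in `ℚ₂`. [cite: Serre1973, Ch. II §3.3 Thm 4] -/
theorem not_isSquare_mul_s_of_even {m : ℤ} (hm : Odd m) (hu : u = 2 * m) {s : ℤ_[2]} (hs : s ^ 2 = -7) (ε : ℤˣ) :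
    ¬ IsSquare ((ε : ℤ) * ((u : ℚ_[2]) * s)) := by
  have hunit : IsUnit ((ε : ℤ) * (m : ℤ_[2]) * s) := by
    refine (IsUnit.mul ?_ ?_).mul (isUnit_of_sq_eq_intCast (c := -7) (by decide) (by rw [hs]; norm_num))
    · rcases Int.units_eq_one_or ε with h | h <;> simp [h]
    · rw [PadicInt.isUnit_iff]; exact norm_intCast_eq_one_of_odd hm
  have h := not_isSquare_two_mul_coe_of_isUnit hunit
  intro hsq
  apply h
  have e : (2 : ℚ_[2]) * ((((ε : ℤ) * (m : ℤ_[2]) * s : ℤ_[2]) : ℚ_[2])) = (ε : ℤ) * ((u : ℚ_[2]) * s) := by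
    rw [hu]; push_cast; ring
  rw [e]; exact hsq

/-- **Key non-square, class `u ≡ 7 (mod 8)`**: for `s² = −7`, `(±u s)² = −7u² ≡ 9 (mod 16)` is not a fourth power
mod `16`, so `±u·s` is not a square in `ℚ₂`. [cite: Serre1973, Ch. II §3.3 Thm 4] -/
theorem not_isSquare_mul_s_of_seven_mod_eight (hu : u % 8 = 7) {s : ℤ_[2]} (hs : s ^ 2 = -7) (ε : ℤˣ) :
    ¬ IsSquare ((ε : ℤ) * ((u : ℚ_[2]) * s)) := by
  have hε : (ε : ℤ) ^ 2 = 1 := by rcases Int.units_eq_one_or ε with h | h <;> simp [h]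
  have hε' : ((ε : ℤ) : ℤ_[2]) ^ 2 = 1 := by exact_mod_cast hε
  have key : ((ε : ℤ) * (u : ℤ_[2]) * s) ^ 2 = ((-7 * u ^ 2 : ℤ) : ℤ_[2]) := by
    push_cast
    linear_combination ((ε : ℤ) : ℤ_[2]) ^ 2 * (u : ℤ_[2]) ^ 2 * hs - 7 * (u : ℤ_[2]) ^ 2 * hε'
  have hc : ∀ x : ZMod (2 ^ 4), x ^ 4 ≠ ((-7 * u ^ 2 : ℤ) : ZMod (2 ^ 4)) := by
    have hcast : ((-7 * u ^ 2 : ℤ) : ZMod (2 ^ 4)) = (((-7 * u ^ 2) % 16 : ℤ) : ZMod (2 ^ 4)) := by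
      rw [show (2 : ℕ) ^ 4 = 16 by norm_num]; exact (ZMod.intCast_mod _ 16).symm
    have hval : (-7 * u ^ 2) % 16 = 9 := by
      have hu16 : u % 16 = 7 ∨ u % 16 = 15 := by omega
      rcases hu16 with h | h
      · have e : u = 16 * (u / 16) + 7 := by omega
        rw [e]; ring_nf; omega
      · have e : u = 16 * (u / 16) + 15 := by omega
        rw [e]; ring_nf; omega
    rw [hcast, hval, show (2 : ℕ) ^ 4 = 16 by norm_num]
    decide
  have h := not_isSquare_coe_of_sq_eq_of_forall_pow_four_ne key hc
  intro hsq
  apply h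
  push_cast
  simpa [mul_assoc] using hsq

include ha hb in
/-- **CLASS I (five 2-adic classes): no point of `V(ℚ₂)` doubles to a non-zero two-torsion point** when
`u ≡ 7 (mod 8)` or `u ≡ 2 (mod 4)`: with `s² = −7` and `x± = (−21u ± us)/2`, `2Q ∉ {T₀, (x₊,0), (x₋,0)}`.
[cite: SilvermanTate2015, §3.5] -/
theorem two_nsmul_ne_twoTorsion_classI (hu : u % 8 = 7 ∨ ∃ m : ℤ, Odd m ∧ u = 2 * m)
    {s : ℤ_[2]} (hs : s ^ 2 = -7) (Q : V.toAffine.Point) {x : ℚ_[2]} (h : V.toAffine.Nonsingular x 0)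
    (hx : x = 0 ∨ x = (-21 * (u : ℚ_[2]) + u * s) / 2 ∨ x = (-21 * (u : ℚ_[2]) - u * s) / 2) :
    2 • Q ≠ .some x 0 h := by
  have hu0 : u ≠ 0 := by
    rcases hu with hu | ⟨m, hm, rfl⟩
    · omega
    · have := Int.odd_iff.mp hm; omega
  have hs' : ((s : ℚ_[2])) ^ 2 = -7 := by exact_mod_cast congrArg ((↑) : ℤ_[2] → ℚ_[2]) hs
  obtain ⟨hsum, hprod⟩ := roots_of_sq_eq V ha hb hs'
  obtain ⟨hrp, hrm⟩ := root_of_sum_prod V hsum hprod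
  -- the two key non-squares `±u s`
  have hns : ∀ ε : ℤˣ, ¬ IsSquare ((ε : ℤ) * ((u : ℚ_[2]) * s)) := fun ε => by
    rcases hu with hu | ⟨m, hm, hum⟩
    · exact not_isSquare_mul_s_of_seven_mod_eight hu hs ε
    · exact not_isSquare_mul_s_of_even hm hum hs ε
  rcases hx with hx | hx | hx
  · subst hx
    exact two_nsmul_ne_twoTorsionPoint V hb hu0 Q
  · subst hx
    refine two_nsmul_ne_of_not_isSquare_sub V (Or.inr hrm) ?_ Q
    rw [root_sub_root]
    simpa using hns 1
  · subst hx
    refine two_nsmul_ne_of_not_isSquare_sub V (Or.inr hrp) ?_ Q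
    have : (-21 * (u : ℚ_[2]) - u * s) / 2 - (-21 * (u : ℚ_[2]) + u * s) / 2 = ((-1 : ℤˣ) : ℤ) * ((u : ℚ_[2]) * s) := by
      push_cast; ring
    rw [this]
    exact hns (-1)

include ha hb in
/-- **CLASS I: every `2`-primary torsion point of `V(ℚ₂)` is killed by `2`** (`u ≡ 7 (mod 8)` or `u ≡ 2 (mod 4)`).
[cite: SilvermanTate2015, §3.5] -/
theorem two_nsmul_eq_zero_of_two_pow_nsmul_eq_zero_classI (hu : u % 8 = 7 ∨ ∃ m : ℤ, Odd m ∧ u = 2 * m) :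
    ∀ (k : ℕ) (P : V.toAffine.Point), 2 ^ k • P = 0 → 2 • P = 0
  | 0, P, hP => by rw [pow_zero, one_nsmul] at hP; rw [hP, nsmul_zero]
  | k + 1, P, hP => by
    obtain ⟨s, hs⟩ := GoldfeldGoodTwists.exists_padicInt_two_sq_eq_neg_seven
    have hs' : ((s : ℚ_[2])) ^ 2 = -7 := by exact_mod_cast congrArg ((↑) : ℤ_[2] → ℚ_[2]) hs
    obtain ⟨hsum, hprod⟩ := roots_of_sq_eq V ha hb hs'
    rw [pow_succ', mul_nsmul] at hP
    have h2 := two_nsmul_eq_zero_of_two_pow_nsmul_eq_zero_classI hu k (2 • P) hP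
    rcases (two_nsmul_eq_zero_iff_of_roots V hsum hprod (2 • P)).mp h2 with h0 | ⟨x, hx, hx3, hPx⟩
    · exact h0
    · exact absurd hPx (two_nsmul_ne_twoTorsion_classI V ha hb hu hs P hx hx3)

include ha hb in
/-- **CLASS I, THE DYADIC TORSION: `V(ℚ₂)[2^∞] = V(ℚ₂)[2] = {O, T₀, T₊, T₋}` has exactly `4` elements**
for `V : y² = x³ + 21u x² + 112u² x` over `ℚ₂` with `u ≡ 7 (mod 8)` or `u ≡ 2 (mod 4)` — i.e. `t([d]₂) = 2` for the
five 2-adic classes `d ≡ 7 (8)`, `d/2 ≡ 1, 3, 5, 7 (8)` of the split-bad class `49a1^{(d)}`.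
[cite: SilvermanTate2015, §3.5] [cite: Serre1973, Ch. II §3.3 Thm 4] -/
theorem natCard_primaryComponent_two_classI (hu : u % 8 = 7 ∨ ∃ m : ℤ, Odd m ∧ u = 2 * m) :
    Nat.card (AddCommGroup.primaryComponent V.toAffine.Point 2) = 4 := by
  have hu0 : u ≠ 0 := by
    rcases hu with hu | ⟨m, hm, rfl⟩
    · omega
    · have := Int.odd_iff.mp hm; omega
  obtain ⟨s, hs⟩ := GoldfeldGoodTwists.exists_padicInt_two_sq_eq_neg_seven
  have hs' : ((s : ℚ_[2])) ^ 2 = -7 := by exact_mod_cast congrArg ((↑) : ℤ_[2] → ℚ_[2]) hs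
  obtain ⟨hsum, hprod⟩ := roots_of_sq_eq V ha hb hs'
  obtain ⟨hrp, hrm⟩ := root_of_sum_prod V hsum hprod
  set xp : ℚ_[2] := (-21 * (u : ℚ_[2]) + u * s) / 2 with hxp
  set xm : ℚ_[2] := (-21 * (u : ℚ_[2]) - u * s) / 2 with hxm
  have hu' : (u : ℚ_[2]) ≠ 0 := by exact_mod_cast hu0
  have hsu : IsUnit s := isUnit_of_sq_eq_intCast (c := -7) (by decide) (by rw [hs]; norm_num)
  have hs0 : (s : ℚ_[2]) ≠ 0 := by rw [PadicInt.coe_ne_zero]; exact hsu.ne_zero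
  have hpm : xp ≠ xm := by
    intro h
    have : (u : ℚ_[2]) * s = 0 := by rw [← root_sub_root (u := u) (s : ℚ_[2]), ← hxp, ← hxm, h, sub_self]
    exact mul_ne_zero hu' hs0 this
  have hp0 : xp ≠ 0 := fun h => by
    have : V.a₄ = 0 := by rw [← hprod, h, zero_mul]
    exact V.a₄_ne_zero this
  have hm0 : xm ≠ 0 := fun h => by
    have : V.a₄ = 0 := by rw [← hprod, h, mul_zero]
    exact V.a₄_ne_zero this
  have hT0 := V.nonsingular_zero_zero
  have hTp : V.toAffine.Nonsingular xp 0 := nonsingular_root V hrp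
  have hTm : V.toAffine.Nonsingular xm 0 := nonsingular_root V hrm
  -- the carrier is the four-element set
  have hset : (AddCommGroup.primaryComponent V.toAffine.Point 2 : Set V.toAffine.Point) =
      {0, .some 0 0 hT0, .some xp 0 hTp, .some xm 0 hTm} := by
    ext P
    simp only [SetLike.mem_coe, AddCommGroup.mem_primaryComponent, Set.mem_insert_iff, Set.mem_singleton_iff]
    constructor
    · rintro ⟨k, hk⟩
      have h2 := two_nsmul_eq_zero_of_two_pow_nsmul_eq_zero_classI V ha hb hu k P hk
      rcases (two_nsmul_eq_zero_iff_of_roots V hsum hprod P).mp h2 with h0 | ⟨x, hx, hx3, rfl⟩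
      · exact Or.inl h0
      · rcases hx3 with rfl | rfl | rfl
        · exact Or.inr (Or.inl rfl)
        · exact Or.inr (Or.inr (Or.inl rfl))
        · exact Or.inr (Or.inr (Or.inr rfl))
    · rintro (rfl | rfl | rfl | rfl)
      · exact ⟨0, by rw [pow_zero, one_nsmul]⟩
      · exact ⟨1, by rw [pow_one]; exact (V.two_nsmul_eq_zero_iff_y_eq_zero hT0).mpr rfl⟩
      · exact ⟨1, by rw [pow_one]; exact (V.two_nsmul_eq_zero_iff_y_eq_zero hTp).mpr rfl⟩
      · exact ⟨1, by rw [pow_one]; exact (V.two_nsmul_eq_zero_iff_y_eq_zero hTm).mpr rfl⟩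
  rw [← SetLike.coe_sort_coe, hset, Nat.card_coe_set_eq]
  rw [Set.ncard_insert_of_notMem (by simp) (by simp),
    Set.ncard_insert_of_notMem (by simp [hp0.symm, hm0.symm]) (by simp),
    Set.ncard_pair (by simp [hpm])]

end Family

end Summit.BirchSwinnertonDyer.BirchSwinnertonDyer.Theorems.PrintCf2.DyadicTorsion
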